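import Mathlib
import Summits.Ventures.PercRepro2.MixChordOCutVertex
import Summits.Ventures.PercRepro2.MixChordOLeafRootMirror

/-!
# The cut-vertex classes along the OTHER `o`-edge `{o, a₂}` (blind cell PercRepro2, night-1 g22;
proofs/NIGHT1-G22.md §4)

MixChordOCutVertex.lean lifts the leaf classes to «`a₃` alone behind a cut vertex `v ∈ {a₁, a₂, o}`» along
`f = {o, a₁}`; the transport `nMixChord_normD_reduced` is root-agnostic, and `{o, a₂}` is a right edge too,
so the mirror theorems of MixChordOLeafRootMirror.lean lift the same way:
**`dChord_o_edge₂_a3_behind_a2`**, **`dChord_o_edge₂_a3_behind_a1`**, **`dChord_o_edge₂_a3_behind_o`**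
and the chain's row **`dz2Chord_o_edge₂_a3_behind_*`**.  Own code; standard axioms.
-/

namespace Summit.Ventures.PercRepro2

open UnionCluster CovForm CutVertexM9 CutOneFar

namespace Mix

section Mirror

variable {V : Type*} {E : Type*} [Fintype E] [DecidableEq E] [Fintype V] [DecidableEq V]
  {R : Type*} [Field R] [LinearOrder R] [IsStrictOrderedRing R]

variable {ends : E → Sym2 V} {side : E → Bool} {L : Set V} {v : V} {Rt : Set V}

/-- **`a₃` alone behind the cut vertex `a₂`: the `o`-class `D`-chord along `{o, a₂}`.** -/
theorem dChord_o_edge₂_a3_behind_a2 (h : CutVertex ends side L v Rt) {p : E → R} (hp : IsProbVec p)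
    {o a₁ a₃ b : V} (hw : a₃ ∈ L) (ho : o ∈ Rt ∨ o = v) (h1 : a₁ ∈ Rt ∨ a₁ = v)
    (hb : b ∈ Rt ∨ b = v) {f : E} (hf : ends f = s(o, v)) (ho2 : o ≠ v) :
    NMixChord (normD ends a₁ v a₃) p ends o a₁ v a₃ b f := by
  have hs := side_eq_false_of_right h hf ho (Or.inr rfl) ho2
  rw [nMixChord_normD_reduced h hw p (marks_right hw ho h1 (Or.inr rfl) hb) hs]
  exact dChord_o_edge₂_of_leaf_either_root _ _ b (isProbVec_rweights_leftProb ends side v a₃ hp)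
    (show rends ends side v a₃ (Sum.inl ⟨f, hs⟩) = s(o, v) from hf)
    (Or.inl (rends_pendant ends side v a₃)) (leaf_reduced h hw) (far_ne_cut h hw)
    (far_ne_right h hw h1) (far_ne_right h hw ho).symm (far_ne_right h hw hb).symm

/-- **`a₃` alone behind the cut vertex `a₁`: the `o`-class `D`-chord along `{o, a₂}`.** -/
theorem dChord_o_edge₂_a3_behind_a1 (h : CutVertex ends side L v Rt) {p : E → R} (hp : IsProbVec p)
    {o a₂ a₃ b : V} (hw : a₃ ∈ L) (ho : o ∈ Rt ∨ o = v) (h2 : a₂ ∈ Rt ∨ a₂ = v)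
    (hb : b ∈ Rt ∨ b = v) {f : E} (hf : ends f = s(o, a₂)) (ho2 : o ≠ a₂) :
    NMixChord (normD ends v a₂ a₃) p ends o v a₂ a₃ b f := by
  have hs := side_eq_false_of_right h hf ho h2 ho2
  rw [nMixChord_normD_reduced h hw p (marks_right hw ho (Or.inr rfl) h2 hb) hs]
  exact dChord_o_edge₂_of_leaf_either_root _ _ b (isProbVec_rweights_leftProb ends side v a₃ hp)
    (show rends ends side v a₃ (Sum.inl ⟨f, hs⟩) = s(o, a₂) from hf)
    (Or.inr (rends_pendant ends side v a₃)) (leaf_reduced h hw) (far_ne_right h hw h2)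
    (far_ne_cut h hw) (far_ne_right h hw ho).symm (far_ne_right h hw hb).symm

/-- **`a₃` alone behind the cut vertex `o`: the `o`-class `D`-chord along `{o, a₂}`.** -/
theorem dChord_o_edge₂_a3_behind_o (h : CutVertex ends side L v Rt) {p : E → R} (hp : IsProbVec p)
    {a₁ a₂ a₃ b : V} (hw : a₃ ∈ L) (h1 : a₁ ∈ Rt ∨ a₁ = v) (h2 : a₂ ∈ Rt ∨ a₂ = v)
    (hb : b ∈ Rt ∨ b = v) {f : E} (hf : ends f = s(v, a₂)) (ho2 : v ≠ a₂) :
    NMixChord (normD ends a₁ a₂ a₃) p ends v a₁ a₂ a₃ b f := by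
  have hs := side_eq_false_of_right h hf (Or.inr rfl) h2 ho2
  rw [nMixChord_normD_reduced h hw p (marks_right hw (Or.inr rfl) h1 h2 hb) hs]
  exact dChord_o_edge₂_of_leaf_o _ _ b (isProbVec_rweights_leftProb ends side v a₃ hp)
    (show rends ends side v a₃ (Sum.inl ⟨f, hs⟩) = s(v, a₂) from hf)
    (rends_pendant ends side v a₃) (leaf_reduced h hw) (far_ne_cut h hw)
    (far_ne_right h hw h1) (far_ne_right h hw h2) (far_ne_right h hw hb).symm

/-- The chain's row along `{o, a₂}`, `a₃` alone behind the cut vertex `a₂`. -/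
theorem dz2Chord_o_edge₂_a3_behind_a2 (h : CutVertex ends side L v Rt) {p : E → R} (hp : IsProbVec p)
    {o a₁ a₃ b : V} (hw : a₃ ∈ L) (ho : o ∈ Rt ∨ o = v) (h1 : a₁ ∈ Rt ∨ a₁ = v)
    (hb : b ∈ Rt ∨ b = v) {f : E} (hf : ends f = s(o, v)) (ho2 : o ≠ v) :
    NMixChord (normDZ2 ends a₁ v a₃) p ends o a₁ v a₃ b f :=
  nMixChord_DZ2_of_D hp (dChord_o_edge₂_a3_behind_a2 h hp hw ho h1 hb hf ho2)
    (HCov_a3_behind_a2 h (hp.update f le_rfl zero_le_one) hw ho h1 hb)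

/-- The chain's row along `{o, a₂}`, `a₃` alone behind the cut vertex `a₁`. -/
theorem dz2Chord_o_edge₂_a3_behind_a1 (h : CutVertex ends side L v Rt) {p : E → R} (hp : IsProbVec p)
    {o a₂ a₃ b : V} (hw : a₃ ∈ L) (ho : o ∈ Rt ∨ o = v) (h2 : a₂ ∈ Rt ∨ a₂ = v)
    (hb : b ∈ Rt ∨ b = v) {f : E} (hf : ends f = s(o, a₂)) (ho2 : o ≠ a₂) :
    NMixChord (normDZ2 ends v a₂ a₃) p ends o v a₂ a₃ b f :=
  nMixChord_DZ2_of_D hp (dChord_o_edge₂_a3_behind_a1 h hp hw ho h2 hb hf ho2)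
    (HCov_a3_behind_a1 h (hp.update f le_rfl zero_le_one) hw ho h2 hb)

/-- The chain's row along `{o, a₂}`, `a₃` alone behind the cut vertex `o`. -/
theorem dz2Chord_o_edge₂_a3_behind_o (h : CutVertex ends side L v Rt) {p : E → R} (hp : IsProbVec p)
    {a₁ a₂ a₃ b : V} (hw : a₃ ∈ L) (h1 : a₁ ∈ Rt ∨ a₁ = v) (h2 : a₂ ∈ Rt ∨ a₂ = v)
    (hb : b ∈ Rt ∨ b = v) {f : E} (hf : ends f = s(v, a₂)) (ho2 : v ≠ a₂) :
    NMixChord (normDZ2 ends a₁ a₂ a₃) p ends v a₁ a₂ a₃ b f :=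
  nMixChord_DZ2_of_D hp (dChord_o_edge₂_a3_behind_o h hp hw h1 h2 hb hf ho2)
    (HCov_a3_behind_o h (hp.update f le_rfl zero_le_one) hw h1 h2 hb)

end Mirror

end Mix

end Summit.Ventures.PercRepro2
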